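import Summits.CriticalPhenomena.PercolationContinuityZ3.Theses.PercBurnResprinkle
import Literature.Probability.Percolation.PercolationProofs
import Literature.Probability.Percolation.StaticRenormalizationBlocks
import Literature.Probability.Percolation.BondPercolationSymmetry
import Literature.Probability.Percolation.CriticalContinuityProofs
import Literature.Probability.LatticeModels.StarBoundary
import Summits.CriticalPhenomena.PercolationContinuityZ3.Theorems.PercBurnResprinkleVacantReignitionGoodBlockDensity
import Summits.CriticalPhenomena.PercolationContinuityZ3.Theorems.PercBurnResprinkleVacantReignitionGluing
import Summits.CriticalPhenomena.PercolationContinuityZ3.Theorems.PercBurnResprinkleVacantReignitionRooting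
import Summits.CriticalPhenomena.PercolationContinuityZ3.Theorems.PercBurnResprinkleVacantReignitionCoarseGlue
import Summits.CriticalPhenomena.PercolationContinuityZ3.Theorems.PercBurnResprinkleVacantReignitionBlockRooting
import Summits.CriticalPhenomena.PercolationContinuityZ3.Theorems.PercBurnResprinkleVacantReignitionLevelShiftCurtain
import Summits.CriticalPhenomena.PercolationContinuityZ3.Theorems.PercBurnResprinkleVacantReignitionNecklacePeierls
import Summits.CriticalPhenomena.PercolationContinuityZ3.Theorems.PercBurnResprinkleVacantReignitionDualityCurtain
import Summits.CriticalPhenomena.PercolationContinuityZ3.Theorems.PercBurnResprinkleVacantReignitionCoarsePercolationCurtain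
import HarnessLib

/-!
# Crux `PercBurnResprinkle.VacantReignition` (stmt-CriticalPhenomena-7203), line `slab-slice-avoidability` — the line's
# theorem-grade output: RE-IGNITION REDUCED TO CURTAIN DUST OF THE CRITICAL ARM SHADOW (unconditionally)

Continuation lead prover-line-stmt-CriticalPhenomena-7203-c2-0, 2026-08-17.  Composes the nine LANDED stubs of the
reshaped line `Cruxes/VacantReignition/Lines/slab_slice_avoidability.lean` (Ahlberg–Duminil-Copin–Kozma–Sidoravicius,
arXiv:1302.6872 §2, separated architecture, run on the tree's (8.90) good blocks of Grimmett's static renormalisation,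
with their one-arm FEWNESS replaced by a first-passage CURTAIN COUNT) into ONE theorem:

* `vacantReignition_of_curtainDust` — the crux `VacantReignition` follows from the ENGINE `CurtainDust` (the registered
  open stub `stub_curtainDust`, verbatim, def-free): for every aspect `k ≥ 1` and `η > 0` there is `κ > 0` such that for
  arbitrarily large block scales `L` and arbitrarily large coarse ratios `S`, with `labelMeasure`-probability `≥ 1 - η`,
  every self-avoiding `★`-chain `γ` of blocks `z ∈ ℤ²`, `|zᵢ| ≤ 3S`, of extent `≥ S` in some coordinate carries at least
  `κ·|γ|` UNTOUCHED blocks (touched: some vertex of the window `(2L+1)(0,z) + B(blockR L k)` has an `ω_{p_c}`-open arm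
  to sup-distance `S(2L+1)`) — ONE random set (the block-resolution shadow of the CRITICAL arm set in a layer of blocks),
  ONE level `p_c`, no `ε`, no limit in `p`; the regime is that of the slab card (resolution `L` fixed, `S → ∞`, where the
  touched density tends to `0` in the continuity world), the currency first-passage ("would-be curtains cost linearly many
  holes").

Ingredients (all landed, kernel-checked): `stub_goodBlockDensity` (p87632, density of good fresh blocks at every
`q ∈ (p_c, 1]`), `stub_levelShiftCurtain` (p152231, the engine's bound moved from `p_c` to `p₁ > p_c` and to every coarse
site), `stub_necklacePeierls` (p152718, `P(NecklaceBad) ≤ η` for large `S` when the bad-block density is `≤ δ(k, κ)` —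
ADKS Lemma 4 as a genuine Peierls estimate over self-avoiding `★`-chains), `stub_coarsePercolationCurtain` (p152240,
finitely dependent planar `★`-Peierls for the two-field coarse process), `stub_dualityCurtain` (p152067, CurtainOK ∧ not
NecklaceBad ⇒ long-way rectangle crossings by vacant ∧ good blocks), `stub_coarseGlue` (p110855), `stub_blockRooting`
(p107770), `stub_gluing` (p87896), `stub_rooting` (p92097).
Bookkeeping: `ε' = min ε (1 - p_c) > 0` (`criticalProb_zd_lt_one`), `q = p_c + ε' ∈ (p_c, 1]`; `k = k(q)`; `η₁`;
`κ = κ(k, η₁/2)` from the engine; `δ(k, κ)`; `L₀(q, δ)`; the engine at `max L₀ 1` gives `L`, the Peierls threshold `S₀`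
and `k + 5` give the lower bound for the engine's `S`; level shift gives the witness `p₁ > p_c`;
`1/2 ≤ μ2(coarse percolation) ≤ μ2(some block of H(0) percolates)`; block rooting, gluing, rooting; monotonicity of the
vacant fresh configuration in the field level (`q ≤ p_c + ε`).
So the crux is CLOSED MODULO ITS ENGINE `CurtainDust` alone (open: continuity-strength through the route, conceded;
not comparable with the engine `HarmlessShadow` of `vacantReignition_of_harmlessShadow` — different limit order).  No new
definitions.
-/

noncomputable section

namespace Summit.CriticalPhenomena.PercolationContinuityZ3.Theorems

open MeasureTheory Set
open Literature.Probability.Percolation Literature.Probability.LatticeModels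

/-- **Re-ignition from curtain dust of the critical arm shadow** (line slab-slice-avoidability assembled):
`CurtainDust → VacantReignition`, unconditionally.  The hypothesis is the registered open stub `stub_curtainDust`
verbatim (def-free); the proof is the skeleton's composition `VacantReignition_of` with the nine landed stubs.
[cite: AhlbergEtAl2015, §2 (Thm 2 and its proof, separated architecture; Lemma 4 with the curtain count)] -/
theorem vacantReignition_of_curtainDust :
    (∀ k : ℕ, 1 ≤ k → ∀ η : ℝ, 0 < η → ∃ κ : ℝ, 0 < κ ∧ ∀ L₁ : ℕ, ∃ L : ℕ, L₁ ≤ L ∧ ∀ S₁ : ℕ, ∃ S : ℕ, S₁ ≤ S ∧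
      (labelMeasure (Fin 3 → ℤ)).real {U : (Sym2 (Fin 3 → ℤ) → ℝ) |
        ¬ (∀ γ : List (Fin 2 → ℤ), γ.Nodup → List.IsChain (fun a b => (zdStar 2).Adj a b) γ → (∀ z ∈ γ, (∀ i, |z i - (S : ℤ) * (0 : Fin 2 → ℤ) i| ≤ 3 * (S : ℤ))) → (∃ z ∈ γ, ∃ z' ∈ γ, ∃ i, (S : ℤ) ≤ |z i - z' i|) → ∃ F : Finset (Fin 2 → ℤ), (∀ z ∈ F, z ∈ γ ∧ ¬ (∃ y ∈ (↑(box 3 (blockR L k)) : Set (Fin 3 → ℤ)), BondConfig.relabel (sym2Equiv (Site.shift (-(((2 * L + 1 : ℕ) : ℤ) • (![0, z 0, z 1] : Fin 3 → ℤ))))) (configOfLabels (criticalProb (zdGraph 3) (0 : Fin 3 → ℤ)) U (zdGraph 3)) ∈ boxArm (S * (2 * L + 1)) y)) ∧ κ * (γ.length : ℝ) ≤ (F.card : ℝ))} ≤ η) →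
    Summit.CriticalPhenomena.PercolationContinuityZ3.Theses.PercBurnResprinkle.VacantReignition := by
  intro h1 ε hε
  have hprob : IsProbabilityMeasure (labelMeasure (Fin 3 → ℤ)) := isProbabilityMeasure_labelMeasure _
  -- the supercritical fresh level `q = p_c + ε' ∈ (p_c, 1]`
  have hpc1 : criticalProb (zdGraph 3) (0 : Fin 3 → ℤ) < 1 := criticalProb_zd_lt_one (d := 3) (by norm_num)
  have hpc0 : 0 ≤ criticalProb (zdGraph 3) (0 : Fin 3 → ℤ) := (criticalProb_mem_Icc _ _).1
  set ε' : ℝ := min ε (1 - criticalProb (zdGraph 3) (0 : Fin 3 → ℤ)) with hε'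
  have hε'pos : 0 < ε' := lt_min hε (by linarith)
  have hε'le : ε' ≤ ε := min_le_left _ _
  have hq1 : criticalProb (zdGraph 3) (0 : Fin 3 → ℤ) + ε' ≤ 1 := by
    have := min_le_right ε (1 - criticalProb (zdGraph 3) (0 : Fin 3 → ℤ)); linarith
  set q : unitInterval := ⟨criticalProb (zdGraph 3) (0 : Fin 3 → ℤ) + ε', by linarith, hq1⟩ with hqdef
  have hq : criticalProb (zdGraph 3) (0 : Fin 3 → ℤ) < (q : ℝ) := by
    show criticalProb (zdGraph 3) (0 : Fin 3 → ℤ) < criticalProb (zdGraph 3) (0 : Fin 3 → ℤ) + ε'; linarith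
  -- constants: `k(q)`, `η₁`, `κ(k, η₁/2)` from the engine, `δ(k, κ)`, `L₀`, `L`, `S`, `p₁`
  obtain ⟨k, hk, hDk⟩ := stub_goodBlockDensity q hq
  obtain ⟨η₁, hη₁, h5⟩ := stub_coarsePercolationCurtain
  obtain ⟨κ, hκ, hEng⟩ := h1 k hk (η₁ / 2) (by positivity)
  obtain ⟨δ, hδ, hNP⟩ := stub_necklacePeierls k hk κ hκ
  obtain ⟨L₀, hL₀⟩ := hDk δ hδ
  obtain ⟨L, hLL, hEngL⟩ := hEng (max L₀ 1)
  have hL1 : 1 ≤ L := le_trans (le_max_right _ _) hLL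
  have hL0 : L₀ ≤ L := le_trans (le_max_left _ _) hLL
  obtain ⟨S₀, hS₀⟩ := hNP L hL1 (q : ℝ) (hL₀ L hL0) η₁ hη₁
  obtain ⟨S, hSS, hCurt⟩ := hEngL (max S₀ (k + 5))
  have hS₀S : S₀ ≤ S := le_trans (le_max_left _ _) hSS
  have hSk : k + 5 ≤ S := le_trans (le_max_right _ _) hSS
  have hS3 : k + 3 ≤ S := by omega
  have hS1 : 1 ≤ S := by omega
  obtain ⟨p₁, hp₁, hshift⟩ := stub_levelShiftCurtain k S L κ (η₁ / 2) η₁ (by linarith) hCurt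
  have hHx := hshift p₁ hp₁.le le_rfl
  have hBx := hS₀ S hS₀S
  -- coarse percolation with probability ≥ 1/2, duality + coarse gluing, block rooting
  have hhalf := h5 k hk κ S L hSk hL1 p₁ (q : ℝ) hHx hBx
  have hroot := stub_blockRooting k S L p₁ (q : ℝ)
    (lt_of_lt_of_le (by norm_num) (hhalf.trans (measureReal_mono ?incl)))
  case incl =>
    rintro π ⟨h0, hinf⟩
    refine stub_coarseGlue k S L hS1 p₁ (q : ℝ) π
      (stub_dualityCurtain k S L hS3 κ p₁ (q : ℝ) 0 π h0.1 h0.2) ?_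
    refine hinf.mono (fun x hx => ?_)
    exact reflTransGen_starRel_mono
      (fun x' hx' => stub_dualityCurtain k S L hS3 κ p₁ (q : ℝ) x' π hx'.1 hx'.2) hx
  -- gluing into a vacant-fresh cluster near the origin, rooting, monotonicity in the field level
  have hnear := lt_of_lt_of_le hroot (measureReal_mono (fun π hπ => stub_gluing L hL1 k hk p₁ (q : ℝ) π hπ))
  have hfin := stub_rooting L p₁ (q : ℝ) hnear
  have hqle : (q : ℝ) ≤ criticalProb (zdGraph 3) (0 : Fin 3 → ℤ) + ε := by
    show criticalProb (zdGraph 3) (0 : Fin 3 → ℤ) + ε' ≤ criticalProb (zdGraph 3) (0 : Fin 3 → ℤ) + ε; linarith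
  refine ⟨p₁, hp₁, lt_of_lt_of_le hfin (measureReal_mono ?_)⟩
  intro π hπ
  refine Set.Infinite.mono (openCluster_mono (fun e he => ?_) 0) hπ
  exact ⟨configOfLabels_mono π.2 (zdGraph 3) hqle he.1, he.2⟩

end Summit.CriticalPhenomena.PercolationContinuityZ3.Theorems

end
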